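import Literature.NumberTheory.EllipticCurves.AnalyticRankOverNumberFieldProofs
import Literature.NumberTheory.EllipticCurves.ComplexMultiplicationBurungaleFlachDescentProofs
import Literature.NumberTheory.EllipticCurves.ComplexMultiplicationTwistIsogenyCertProofs
import Literature.NumberTheory.EllipticCurves.ComplexMultiplicationLFunctionIsogenyHoldsProofs
import HarnessLib

/-!
# Over its own CM field the analytic rank of a CM curve doubles: `r_an(E/K) = 2 · r_an(E/ℚ)`

`Proofs` file (theorems only, no new named fact) of the CM cluster
`Literature.NumberTheory.EllipticCurves.ComplexMultiplication*`: the **degenerate quadratic base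
change** of a CM elliptic curve `E/ℚ` to its CM field `K`.

For `E/ℚ` with complex multiplication by the maximal order of the imaginary quadratic field `K`
(`j(E) ∈ maximalCMJInvariants`, `IsCMFieldOfJ K j(E)`), the twist `E^{(d_K)} = E ⊗ ω_K` is
`ℚ`-ISOGENOUS to `E` (Burungale–Flach, proof of Cor. 2, via Milne 1972 Thm. 3; in the tree the
theorem `isIsogenous_quadraticTwist_cmFieldDiscr_holds`), so the Artin factorisation of the base
change `L(E/K, s) = L(E, s) · L(E^{(d_K)}, s)` (Ireland–Rosen, Prop. 20.5.4 (b); tree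
`WeierstrassCurve.analyticRankOver_eq_add_of_hasEntireLFunction_rat`) reads
`L(E/K, s) = L(E, s)²` up to the isogeny-invariance of `L` (Knapp, Thm. 11.67; tree
`analyticRank_eq_of_isIsogenous'`), and

> `ord_{s=1} L(E/K, s) = 2 · ord_{s=1} L(E, s)`.

In particular a CM curve of analytic rank ONE over `ℚ` has analytic rank TWO (even, sign `+1`)
over its CM field: relative to the pair `(E, K)` — the setting of anticyclotomic `p`-adic
`L`-functions / Heegner-point / theta-element constructions for `E` and an imaginary quadratic
field — the central value `L(E/K, 1)` vanishes to order two, and rank-one information about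
`E/ℚ` is not visible at the bottom layer of objects interpolating `L(E/K, χ, 1)`. This is the
kernel half of bullet (E)(d) of the barrier entry
`Literature.Barriers.BirchSwinnertonDyer.CMRankOneAtRamifiedPrime` (cell `bsd-print-cfram`,
lit dossier `run/shared/lean/pub/bsd-print-cfram/DOSSIER.md` §41 (d)).

Modularity enters only as the usual named-fact binder `WeierstrassCurve.hasEntireLFunction_rat`
(analytic continuation of `L(E, s)` for every elliptic `E/ℚ`), exactly as in
`WeierstrassCurve.analyticRankOver_eq_add_of_hasEntireLFunction_rat`; everything else is a theorem
of the tree.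

* `analyticRankOver_cmField_eq_two_mul` — `r_an(E/K) = 2 · r_an(E)` for `j(E) ∈
  maximalCMJInvariants` and `K` the CM field;
* `analyticRankOver_cmField_eq_two_of_analyticRank_eq_one` — the rank-one leaf form
  (`r_an(E) = 1 ⇒ r_an(E/K) = 2`);
* `even_analyticRankOver_cmField` — `r_an(E/K)` is even.

The four CM `j`-invariants of NON-maximal orders (`54000, 287496, -12288000, 16581375`) are
`ℚ`-isogenous to maximal-order curves with the same CM field
(`exists_isIsogenous_j_mem_maximalCMJInvariants_of_hasCM_holds`, Silverman *Advanced Topics*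
Ex. 2.12 (b)); analytic ranks over `ℚ` and over `K` are isogeny invariants, so the statements
transfer — not restated here.

## References

* K. Ireland, M. Rosen, *A Classical Introduction to Modern Number Theory*, 2nd ed., GTM 84
  (1990), Ch. 20 §5, Prop. 20.5.4 (b). [IrelandRosen1990]
* A. Burungale, M. Flach, *The conjecture of Birch and Swinnerton-Dyer for certain elliptic curves
  with complex multiplication*, Camb. J. Math. 12 (2024), proof of Cor. 2 (arXiv:2206.09874 p. 4:
  "`E_ε` is isogenous to `E`"). [BurungaleFlach2024]
* A. W. Knapp, *Elliptic Curves*, Math. Notes 40 (1992), Thm. 11.67. [Knapp1993]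
* B. H. Gross, *Arithmetic on Elliptic Curves with Complex Multiplication*, LNM 776 (1980), §18
  (`L(A/F, s)` as a product of Hecke `L`-series). [Gross1980]
-/

noncomputable section

open scoped Classical

open WeierstrassCurve

namespace Literature.NumberTheory.EllipticCurves

/-- **`r_an(E/K) = 2 · r_an(E)` over the CM field.** For an elliptic curve `E/ℚ` with CM by the
maximal order (`j(E) ∈ maximalCMJInvariants`) and `K` its CM field (`IsCMFieldOfJ K j(E)`:
`[K : ℚ] = 2` and `d_K`-square-root in `K`), granted analytic continuation of `L(E', s)` for
elliptic curves over `ℚ` (`WeierstrassCurve.hasEntireLFunction_rat`):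
`ord_{s=1} L(E/K, s) = 2 · ord_{s=1} L(E, s)`. Proof: `r_an(E/K) = r_an(E) + r_an(E^{(disc K)})`
(`analyticRankOver_eq_add_of_hasEntireLFunction_rat`, Ireland–Rosen 20.5.4 (b)),
`E ~ E^{(disc K)}` over `ℚ` (`isIsogenous_quadraticTwist_discr_of_isCMFieldOfJ` fed with the
theorem `isIsogenous_quadraticTwist_cmFieldDiscr_holds`, Burungale–Flach proof of Cor. 2), and
`r_an` is an isogeny invariant (`analyticRank_eq_of_isIsogenous'`, Knapp 11.67).
[cite: IrelandRosen1990, Ch. 20 §5, Prop. 20.5.4(b)]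
[cite: BurungaleFlach2024, proof of Cor. 2 (arXiv p. 4)] [cite: Knapp1993, Thm. 11.67] -/
theorem analyticRankOver_cmField_eq_two_mul (hE : WeierstrassCurve.hasEntireLFunction_rat)
    (W : WeierstrassCurve ℚ) [W.IsElliptic] (hj : W.j ∈ maximalCMJInvariants)
    (K : Type) [Field K] [NumberField K] (hK : IsCMFieldOfJ K W.j) :
    W.analyticRankOver K = 2 * W.analyticRank := by
  have hD : (NumberField.discr K : ℚ) ≠ 0 := by exact_mod_cast NumberField.discr_ne_zero K
  haveI := W.isElliptic_quadraticTwist hD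
  have hiso : IsIsogenous W (W.quadraticTwist (NumberField.discr K : ℚ)) :=
    isIsogenous_quadraticTwist_discr_of_isCMFieldOfJ isIsogenous_quadraticTwist_cmFieldDiscr_holds
      W hj K hK
  rw [W.analyticRankOver_eq_add_of_hasEntireLFunction_rat K hE hK.1,
    ← analyticRank_eq_of_isIsogenous' hiso, two_mul]

/-- **Rank-one leaf form**: a CM curve (maximal order) of analytic rank ONE over `ℚ` has analytic
rank TWO over its CM field — `L(E/K, s)` vanishes to order exactly `2` at `s = 1` (even order,
sign `+1`), granted `WeierstrassCurve.hasEntireLFunction_rat`.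
[cite: IrelandRosen1990, Ch. 20 §5, Prop. 20.5.4(b)]
[cite: BurungaleFlach2024, proof of Cor. 2 (arXiv p. 4)] -/
theorem analyticRankOver_cmField_eq_two_of_analyticRank_eq_one
    (hE : WeierstrassCurve.hasEntireLFunction_rat)
    (W : WeierstrassCurve ℚ) [W.IsElliptic] (hj : W.j ∈ maximalCMJInvariants)
    (K : Type) [Field K] [NumberField K] (hK : IsCMFieldOfJ K W.j) (h1 : W.analyticRank = 1) :
    W.analyticRankOver K = 2 := by
  rw [analyticRankOver_cmField_eq_two_mul hE W hj K hK, h1]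

/-- **Parity**: over its CM field the analytic rank of a CM curve (maximal order) is EVEN,
granted `WeierstrassCurve.hasEntireLFunction_rat`.
[cite: IrelandRosen1990, Ch. 20 §5, Prop. 20.5.4(b)]
[cite: BurungaleFlach2024, proof of Cor. 2 (arXiv p. 4)] -/
theorem even_analyticRankOver_cmField (hE : WeierstrassCurve.hasEntireLFunction_rat)
    (W : WeierstrassCurve ℚ) [W.IsElliptic] (hj : W.j ∈ maximalCMJInvariants)
    (K : Type) [Field K] [NumberField K] (hK : IsCMFieldOfJ K W.j) :
    Even (W.analyticRankOver K) :=
  ⟨W.analyticRank, by rw [analyticRankOver_cmField_eq_two_mul hE W hj K hK, two_mul]⟩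

end Literature.NumberTheory.EllipticCurves

end
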